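import Summits.HodgeConjecture.HodgeConjecture.Theorems.TropicalWeilObstructionTropicalHodgeBoundCertDataB
import Summits.HodgeConjecture.HodgeConjecture.Theorems.TropicalWeilObstructionTropicalHodgeBoundCertDataC

/-!
# Crux `TropicalHodgeBound` (stmt-HodgeConjecture-18480), stub 4 — part C4.5: kernel run of the
# certificate, chunks 29–35

Route `TropicalWeilObstruction` of `HodgeConjecture`, registered line `birth`, stub
`stub_rationalHodgeCoordinates`. Each theorem states that one chunk of the propagation certificate
(`…CertData*`) passes the checker `Chk.checkChunk` of `…ChkCore` (incoming boundary facts, packed steps,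
outgoing boundary facts, final unknowns); proved by `decide +kernel` (pure integer/list computation,
≈ 10⁶–10⁷ kernel reductions per chunk, hence the raised `maxHeartbeats`/`maxRecDepth`). Soundness of the
checker (`…CheckerSound`, `…CheckerEquations`) turns these into linear relations among the integer
coordinates of a tropical cycle class (`…Certificate`).

References: [Zharkov2020TropicalWeil] I. Zharkov, arXiv:2002.02347, §2; [MikhalkinZharkov2014Eigenwave]
G. Mikhalkin, I. Zharkov, LN UMI 15 (2014), Thm. 5.4.
-/

set_option linter.dupNamespace false

namespace Summit.HodgeConjecture.HodgeConjecture.Theorems.TropicalHodgeBound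

namespace Chk

set_option maxRecDepth 100000 in
set_option maxHeartbeats 400000000 in
/-- Chunk `29` of the certificate passes the checker. [cite: Zharkov2020TropicalWeil, §2] -/
theorem chunk29_ok : checkChunk [] ch29 [] (ch29.map stepTarget) = true := by
  decide +kernel

set_option maxRecDepth 100000 in
set_option maxHeartbeats 400000000 in
/-- Chunk `30` of the certificate passes the checker. [cite: Zharkov2020TropicalWeil, §2] -/
theorem chunk30_ok : checkChunk [] ch30 [] (ch30.map stepTarget) = true := by
  decide +kernel

set_option maxRecDepth 100000 in
set_option maxHeartbeats 400000000 in
/-- Chunk `31` of the certificate passes the checker. [cite: Zharkov2020TropicalWeil, §2] -/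
theorem chunk31_ok : checkChunk [] ch31 [] (ch31.map stepTarget) = true := by
  decide +kernel

set_option maxRecDepth 100000 in
set_option maxHeartbeats 400000000 in
/-- Chunk `32` of the certificate passes the checker. [cite: Zharkov2020TropicalWeil, §2] -/
theorem chunk32_ok : checkChunk [] ch32 [] (ch32.map stepTarget) = true := by
  decide +kernel

set_option maxRecDepth 100000 in
set_option maxHeartbeats 400000000 in
/-- Chunk `33` of the certificate passes the checker. [cite: Zharkov2020TropicalWeil, §2] -/
theorem chunk33_ok : checkChunk [] ch33 [] (ch33.map stepTarget) = true := by
  decide +kernel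

set_option maxRecDepth 100000 in
set_option maxHeartbeats 400000000 in
/-- Chunk `34` of the certificate passes the checker. [cite: Zharkov2020TropicalWeil, §2] -/
theorem chunk34_ok : checkChunk [] ch34 [] (ch34.map stepTarget) = true := by
  decide +kernel

set_option maxRecDepth 100000 in
set_option maxHeartbeats 400000000 in
/-- Chunk `35` of the certificate passes the checker. [cite: Zharkov2020TropicalWeil, §2] -/
theorem chunk35_ok : checkChunk [] ch35 [] (ch35.map stepTarget) = true := by
  decide +kernel

end Chk

end Summit.HodgeConjecture.HodgeConjecture.Theorems.TropicalHodgeBound
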